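import Summits.ABC.IUTFork.Cor312EdgeRegions
import HarnessLib

/-!
# [IUTchIII] Corollary 3.12 — readings of the edge, III: containment up to isomorphism (Yamashita) (c312 crew, V-d)

Record-only file (D-0012) of the abc-iut cell (Cor. 3.12 strategy TEAM A «direct III§3», seat
abc-iut-c312-10; board row W2-I of `HOME/plan/COR312-ASSIGNMENTS.md`); TAKES NO SIDE. `Cor312EdgeRegions.lean`
(V-b) reads the disputed edge of the printed proof of [IUTchIII] Cor. 3.12 — (xi-f), p. 184: from
"constitutes … a construction … of … `−|log(q)|`" (`Obs.constitutesConstruction`) to "The inclusion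
`−|log(q)| ∈ ℝ_{≤−|log(Θ)|}` … then follows formally" — at region level over a skeleton `Cor312Setting`,
as three candidate readings: `RepresentedVol` (R1, LANA §8.3), `QSubHull` (R2), `QIsImage` (R3). This file
adds the FOURTH printed rendering of the same step, the one in Go Yamashita's survey proof of his
Cor. 13.13 (= [IUTchIII] Cor. 3.12):

* "Then Corollary follows by comparing the log-volumes (Note that log-volumes are invariant under
  (Indet ⤸), (Indet →), and also compatible with log-Kummer correspondence of Theorem 13.12 (2)) of
  (1,0)-labelled q-pilot objects … and (1,∘)-labelled Θ-pilot objects, since, in the mono-analytic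
  containers (i.e., ℚ-spans of log-shells), the holomorphic hull of the union of possible images of
  Θ-pilot objects subject to indeterminacies (Indet ⤸), (Indet →), (Indet ↑) **contains a region which is
  isomorphic (not equal) to the region determined by the q-pilot objects** (This means that "very small
  region with indeterminacies" contains "almost unit region")."
  [cite: Yamashita2024IUTSurvey, Cor. 13.13 proof, printed p. 360 = PDF p. 390, ll. 30–40]

READING 4 (`QCopyInHull`): the hull contains an admissible region of the SAME log-volume as the q-pilot
image. At this schematic level (the container carries no ambient isomorphism group) "isomorphic (not
equal)" is rendered by exactly the consequence Yamashita's parenthetical licenses and his comparison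
consumes — equality of log-volumes; the explicit packet-level isomorphisms and the invariance of the
log-volume under (Ind1)/(Ind2) are typed elsewhere (abc-iut-c312-d1 `HaarTransport`, abc-iut-c312-5
`Thm311RealLattice`), deliberately not here. `QCopyInHullApprox` types the (xi-f) hedge "[perhaps only up
to some sort of "approximation", as a result of various indeterminacies]" (p. 184, read on the page).

PROVED (each a one-to-five-line kernel fact; none asserts any reading):
* `cor312_of_qCopyInHull`, `cor312_of_qCopyInHullApprox` — Reading 4, exact or approximate, yields the
  inequality (monotonicity of `ln ν̄`; for the approximate form, an `ε`-argument).
* R1 → R4 (`qCopyInHull_of_representedVol`: take `R := U i`), R2 → R4 (`qCopyInHull_of_qSubHull`: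
  take `R := Q`), R3 → R4, LANA (9-1) → R4 (`qCopyInHull_of_mainGoal`) — Reading 4 is implied by EVERY
  reading previously catalogued.
* `qCopyInHull_not_imp_readings` — a finite container in which R4 holds while R1, R2, R3 all fail
  (the isomorphic copy `{0}` of the q-image `{0, 5}` lies in the hull `{0, 1}`; the q-image itself does
  not, and no possible image has its volume): Reading 4 is STRICTLY weaker than each of R1–R3.
* `cor312_not_imp_qCopyInHull` — a container with coarse admissibility in which the inequality holds
  while R4 fails: Reading 4 still says strictly more than the inequality (cf. `readings_differ`,
  `edge_not_imp_readings`). So at region level R1, R2, R3 ⇒ R4 ⇒ `Cor312`, both gaps strict: Reading 4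
  is the WEAKEST catalogued reading of (xi-f) that still yields Cor. 3.12.
* Chain wiring (as for R1–R3 in V-b): `realEdges_of_qCopyInHull_reading`,
  `realEdges_of_qCopyInHullApprox_reading`, `setting_cor312_of_chain_qCopy`.

Tagging note (R8-N1 convention of V-b/XVII): like R1–R3, Reading 4 is a reading of the SAME disputed
passage ([IUTchIII] Cor. 3.12 proof, Step (xi-f) p. 184); the `cite` attribute records whose RENDERING it
is (Yamashita's), the claim tag records whose claim it renders — no reading is privileged by its tag.
Print nit recorded by the cell's literature seat: Yamashita's Cor. 13.13 statement twice prints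
"Theorem 13.13 (1)" where Theorem 13.12 (1) is meant (p. 389 l. 34, p. 390 l. 2).
Sources read on the page (this seat's renders): [IUTchIII] kurims 2020 text `paper:url-4b091feeb646`
p. 184 (Step (xi-f)); Yamashita, "A proof of the abc conjecture after Mochizuki", 25 Jun 2024 kurims text
`paper:url-8e9e3321a672` pp. 389–390 (printed 359–360). [claim: Mochizuki2012, status: disputed]
Deliberately NOT here: which reading (if any) [IUTchIII] Thm. 3.11 supplies; the packet-level isomorphism
data; the verbatim-side (`Cor312.Setting`) instantiation (offered to the W2-C′ holder, board 23:14Z);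
any judgement.
-/

noncomputable section

open Set

namespace Summit.ABC

namespace IUTFork

namespace Cor312Setting

variable (C : Cor312Setting)

/-! ## 1. Reading 4: the hull contains an isomorphic copy of the q-pilot image -/

/-- READING 4 (regions, containment up to isomorphism) — Yamashita's rendering of Step (xi): "the
holomorphic hull of the union of possible images of Θ-pilot objects subject to indeterminacies … contains
a region which is **isomorphic (not equal)** to the region determined by the q-pilot objects" (Cor. 13.13
proof, printed p. 360 = PDF p. 390, ll. 35–40). "Isomorphic" is rendered by the consequence his comparison
consumes — the copy is admissible with THE SAME log-volume as the q-pilot image ("Note that log-volumes are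
invariant under (Indet ⤸), (Indet →) …", ibid. ll. 30–32; the packet-level isomorphisms themselves are
c312-d1 `HaarTransport` / c312-5 `Thm311RealLattice` material, not typable in a bare `VolumeContainer`).
HYPOTHESIS; never asserted. [cite: Yamashita2024IUTSurvey, Cor. 13.13 proof, p. 360 (PDF p. 390) ll. 30–40] -/
@[cite "Yamashita2024IUTSurvey" "Cor. 13.13 proof, p. 360 (PDF p. 390) ll. 30–40"]
def QCopyInHull : Prop :=
  ∃ R : Set C.L, C.Adm R ∧ R ⊆ C.Uhol ∧ C.logvol R = C.negAbsLogq

/-- READING 4, APPROXIMATE FORM — the (xi-f) hedge as printed: the construction is "a construction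
[**perhaps only up to some sort of "approximation"**, as a result of various indeterminacies] of the
pilot-object log-volume of the input data …, namely, `−|log(q)| ∈ ℝ`" ([IUTchIII] Cor. 3.12 proof,
Step (xi-f), p. 184): for every `ε > 0` the hull contains an admissible region whose log-volume is within
`ε` of `−|log(q)|`. HYPOTHESIS; never asserted. [claim: Mochizuki2012, status: disputed] -/
@[claim "Mochizuki2012" "disputed"]
def QCopyInHullApprox : Prop :=
  ∀ ε : ℝ, 0 < ε → ∃ R : Set C.L, C.Adm R ∧ R ⊆ C.Uhol ∧ |C.logvol R - C.negAbsLogq| ≤ ε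

/-- **Reading 4 ⟹ Cor. 3.12** — Yamashita's "Then Corollary follows by comparing the log-volumes":
the copy's volume is `−|log(q)|` and, by monotonicity of `ln ν̄`, at most `−|log(Θ)|`. [folklore] -/
theorem cor312_of_qCopyInHull (h : C.QCopyInHull) : C.Cor312 := by
  obtain ⟨R, hAdm, hSub, hVol⟩ := h
  show C.negAbsLogq ≤ C.negLogTheta
  rw [← hVol]
  exact C.logvol_mono hAdm C.adm_Uhol hSub

/-- An exact copy is an approximate copy. [folklore] -/
theorem qCopyInHullApprox_of_qCopyInHull (h : C.QCopyInHull) : C.QCopyInHullApprox := by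
  obtain ⟨R, hAdm, hSub, hVol⟩ := h
  intro ε hε
  exact ⟨R, hAdm, hSub, by rw [hVol, sub_self, abs_zero]; exact hε.le⟩

/-- **Reading 4, approximate form ⟹ Cor. 3.12**: volumes `≥ −|log(q)| − ε` occur below `−|log(Θ)|` for
every `ε > 0`, so `−|log(q)| ≤ −|log(Θ)|` — the printed "approximation" hedge costs nothing for the
inequality. [folklore] -/
theorem cor312_of_qCopyInHullApprox (h : C.QCopyInHullApprox) : C.Cor312 := by
  show C.negAbsLogq ≤ C.negLogTheta
  have key : ∀ ε : ℝ, 0 < ε → C.negAbsLogq - ε ≤ C.negLogTheta := by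
    intro ε hε
    obtain ⟨R, hAdm, hSub, hVol⟩ := h ε hε
    have hmono : C.logvol R ≤ C.logvol C.Uhol := C.logvol_mono hAdm C.adm_Uhol hSub
    have hlow : -ε ≤ C.logvol R - C.negAbsLogq := (abs_le.mp hVol).1
    have hNLT : C.negLogTheta = C.logvol C.Uhol := rfl
    linarith
  rcases lt_or_ge C.negLogTheta C.negAbsLogq with hlt | hge
  · exfalso
    have := key ((C.negAbsLogq - C.negLogTheta) / 2) (by linarith)
    linarith
  · exact hge

/-! ## 2. Reading 4 is implied by every previously catalogued reading -/

/-- R1 ⟹ R4: a possible image of the q-pilot log-volume (LANA's `RepresentedVol`) is itself a copy in the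
hull (`U i ⊆ U^{hol}`). [folklore] -/
theorem qCopyInHull_of_representedVol (h : C.RepresentedVol) : C.QCopyInHull := by
  obtain ⟨i, hi⟩ := h
  exact ⟨C.U i, C.U_adm i, C.U_subset_Uhol i, hi⟩

/-- R2 ⟹ R4: if the q-pilot image itself lies in the hull, it is its own copy ("isomorphic" does not
exclude equal at this level; Yamashita's "not equal" is about the intended model, not a requirement).
[folklore] -/
theorem qCopyInHull_of_qSubHull (h : C.QSubHull) : C.QCopyInHull :=
  ⟨C.Q, C.Q_adm, h, rfl⟩

/-- R3 ⟹ R4 (through R2). [folklore] -/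
theorem qCopyInHull_of_qIsImage (h : C.QIsImage) : C.QCopyInHull :=
  C.qCopyInHull_of_qSubHull (C.qSubHull_of_qIsImage h)

/-- LANA's (9-1) for the carried `η`-setting ⟹ R4 (through R1 = `mainGoal_iff_representedVol`).
[cite: LANA2026Report, §9.2 (9-1) p. 46] -/
theorem qCopyInHull_of_mainGoal (Rval : PointedLine) (h : (C.toEtaSetting Rval).MainGoal) :
    C.QCopyInHull :=
  C.qCopyInHull_of_representedVol ((C.mainGoal_iff_representedVol Rval).1 h)

end Cor312Setting

/-! ## 3. Strictness: R4 is weaker than R1–R3 and stronger than the inequality -/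

/-- **Reading 4 does not give back any of R1–R3**: in `witnessSetting` (one possible image `{0, 1}` of
log-volume `2`, q-pilot image `{0, 5}` of log-volume `1`, hull = identity) the singleton `{0}` is an
admissible region of log-volume `1` inside the hull — an "isomorphic (not equal) copy" of the q-image —
so R4 holds; while no possible image has log-volume `1` (R1 fails), `{0, 5} ⊄ {0, 1}` (R2 fails), and
`{0, 1} ≠ {0, 5}` (R3 fails). [folklore] -/
theorem qCopyInHull_not_imp_readings :
    ∃ C : Cor312Setting, C.QCopyInHull ∧ ¬ C.RepresentedVol ∧ ¬ C.QSubHull ∧ ¬ C.QIsImage := by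
  have hU : (⋃ _ : Unit, ({0, 1} : Set ℕ)) = {0, 1} := Set.iUnion_const _
  have h0 : witnessContainer.logvol ({0} : Set ℕ) = 1 := by
    simp only [witnessContainer, Set.indicator_apply, Set.mem_singleton_iff]
    norm_num
  have h01 : witnessContainer.logvol ({0, 1} : Set ℕ) = 2 := by
    simp only [witnessContainer, Set.indicator_apply, Set.mem_insert_iff, Set.mem_singleton_iff]
    norm_num
  have h05 : witnessContainer.logvol ({0, 5} : Set ℕ) = 1 := by
    simp only [witnessContainer, Set.indicator_apply, Set.mem_insert_iff, Set.mem_singleton_iff]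
    norm_num
  have hhol : witnessSetting.Uhol = ({0, 1} : Set ℕ) := by
    show ClosureOperator.id (Set ℕ) (⋃ _ : Unit, ({0, 1} : Set ℕ)) = {0, 1}
    rw [hU]
    rfl
  refine ⟨witnessSetting, ⟨({0} : Set ℕ), trivial, ?_, ?_⟩, ?_, ?_, ?_⟩
  · have h0mem : (0 : ℕ) ∈ witnessSetting.U () := by
      show (0 : ℕ) ∈ ({0, 1} : Set ℕ)
      simp
    exact Set.singleton_subset_iff.mpr (witnessSetting.U_subset_Uhol () h0mem)
  · show witnessContainer.logvol ({0} : Set ℕ) = witnessContainer.logvol ({0, 5} : Set ℕ)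
    rw [h0, h05]
  · rintro ⟨_, h⟩
    change witnessContainer.logvol ({0, 1} : Set ℕ) = witnessContainer.logvol ({0, 5} : Set ℕ) at h
    rw [h01, h05] at h
    norm_num at h
  · intro h
    have h5' : (5 : ℕ) ∈ witnessSetting.Uhol := h (show (5 : ℕ) ∈ ({0, 5} : Set ℕ) by simp)
    rw [hhol] at h5'
    have h5 : (5 : ℕ) ∈ ({0, 1} : Set ℕ) := h5'
    simp at h5
  · rintro ⟨i, h⟩
    have hUi : witnessSetting.U i = ({0, 1} : Set ℕ) := rfl
    have hQ : witnessSetting.Q = ({0, 5} : Set ℕ) := rfl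
    rw [hUi, hQ] at h
    have h5 : (5 : ℕ) ∈ ({0, 1} : Set ℕ) := by
      rw [h]
      simp
    simp at h5

/-- A container with COARSE admissibility: only `∅`, `{0, 1}`, `{0, 5}` are admissible; log-volume and
hull as in `witnessContainer`. [folklore] -/
def coarseContainer : VolumeContainer where
  L := ℕ
  Adm A := A = ∅ ∨ A = ({0, 1} : Set ℕ) ∨ A = ({0, 5} : Set ℕ)
  logvol A := A.indicator (fun _ => (1 : ℝ)) 0 + A.indicator (fun _ => (1 : ℝ)) 1
  logvol_mono _ _ _ _ hAB :=
    add_le_add (Set.indicator_le_indicator_of_subset hAB (fun _ => zero_le_one) 0)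
      (Set.indicator_le_indicator_of_subset hAB (fun _ => zero_le_one) 1)
  hull := ClosureOperator.id (Set ℕ)

/-- The coarse setting: one possible image `{0, 1}`, q-pilot image `{0, 5}`, hull = identity — as in
`witnessSetting` but with no admissible region other than `∅`, `{0, 1}`, `{0, 5}`. [folklore] -/
def coarseSetting : Cor312Setting where
  toVolumeContainer := coarseContainer
  Idx := Unit
  U _ := ({0, 1} : Set ℕ)
  U_adm _ := Or.inr (Or.inl rfl)
  Uhol_adm := Or.inr (Or.inl (by
    show ClosureOperator.id (Set ℕ) (⋃ _ : Unit, ({0, 1} : Set ℕ)) = {0, 1}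
    rw [Set.iUnion_const]
    rfl))
  Q := ({0, 5} : Set ℕ)
  Q_adm := Or.inr (Or.inr rfl)

/-- **The inequality does not give back Reading 4**: in the coarse setting Cor. 3.12 holds (`1 ≤ 2`) while
NO admissible region in the hull has the q-pilot log-volume — `∅` has volume `0`, `{0, 1}` has volume `2`,
and `{0, 5}` is not contained in the hull `{0, 1}`. With `readings_differ` / `edge_not_imp_readings`
(V-b): at region level R1, R2, R3 ⇒ R4 ⇒ `Cor312`, and BOTH gaps are strict — Reading 4 is the weakest
catalogued reading of Step (xi-f) that still yields the inequality. [folklore] -/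
theorem cor312_not_imp_qCopyInHull :
    ∃ C : Cor312Setting, C.Cor312 ∧ ¬ C.QCopyInHull := by
  have hU : (⋃ _ : Unit, ({0, 1} : Set ℕ)) = {0, 1} := Set.iUnion_const _
  have hempty : coarseContainer.logvol (∅ : Set ℕ) = 0 := by
    simp only [coarseContainer, Set.indicator_apply, Set.mem_empty_iff_false]
    norm_num
  have h01 : coarseContainer.logvol ({0, 1} : Set ℕ) = 2 := by
    simp only [coarseContainer, Set.indicator_apply, Set.mem_insert_iff, Set.mem_singleton_iff]
    norm_num
  have h05 : coarseContainer.logvol ({0, 5} : Set ℕ) = 1 := by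
    simp only [coarseContainer, Set.indicator_apply, Set.mem_insert_iff, Set.mem_singleton_iff]
    norm_num
  have hhol : coarseSetting.Uhol = ({0, 1} : Set ℕ) := by
    show ClosureOperator.id (Set ℕ) (⋃ _ : Unit, ({0, 1} : Set ℕ)) = {0, 1}
    rw [hU]
    rfl
  refine ⟨coarseSetting, ?_, ?_⟩
  · show coarseContainer.logvol ({0, 5} : Set ℕ) ≤ coarseContainer.logvol coarseSetting.Uhol
    rw [hhol, h01, h05]
    norm_num
  · rintro ⟨R, hAdm, hSub, hVol⟩
    change coarseContainer.logvol R = coarseContainer.logvol ({0, 5} : Set ℕ) at hVol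
    rw [h05] at hVol
    rcases hAdm with rfl | rfl | rfl
    · rw [hempty] at hVol
      norm_num at hVol
    · rw [h01] at hVol
      norm_num at hVol
    · rw [hhol] at hSub
      have h5 : (5 : ℕ) ∈ ({0, 1} : Set ℕ) := hSub (show (5 : ℕ) ∈ ({0, 5} : Set ℕ) by simp)
      simp at h5

/-! ## 4. The chain wiring: Reading 4 gives the real edges, exactly as R1–R3 do in V-b -/

namespace Cor312Proof

open Cor312Setting

variable (C : Cor312Setting) (hq : C.negAbsLogq < 0)

/-- Reading the (xi-f) sentence as `QCopyInHull` (Yamashita's containment up to isomorphism) gives the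
chain's real edges. [cite: Yamashita2024IUTSurvey, Cor. 13.13 proof, p. 360 (PDF p. 390) ll. 30–40] -/
theorem realEdges_of_qCopyInHull_reading {O : Obs → Prop}
    (h : O .constitutesConstruction → C.QCopyInHull) : RealEdges O (Volumes.ofSetting C hq) :=
  (realEdges_ofSetting_iff C hq O).2 fun hc => C.cor312_of_qCopyInHull (h hc)

/-- … and so does its approximate form (the printed "approximation" hedge of (xi-f)).
[claim: Mochizuki2012, status: disputed] -/
theorem realEdges_of_qCopyInHullApprox_reading {O : Obs → Prop}
    (h : O .constitutesConstruction → C.QCopyInHullApprox) : RealEdges O (Volumes.ofSetting C hq) :=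
  (realEdges_ofSetting_iff C hq O).2 fun hc => C.cor312_of_qCopyInHullApprox (h hc)

/-- **Loci ∧ chain ∧ Reading 4 at region level ⟹ Cor. 3.12 for the setting** (the V-b composition for
the fourth reading). [claim: Mochizuki2012, status: disputed] -/
theorem setting_cor312_of_chain_qCopy {L : Locus → Prop} {O : Obs → Prop} (hL : ∀ c, L c)
    (hC : Chain L O) (h : O .constitutesConstruction → C.QCopyInHull) : C.Cor312 :=
  C.cor312_of_qCopyInHull (h (constitutesConstruction_of_chain hL hC))

end Cor312Proof

end IUTFork

end Summit.ABC

end
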